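import Literature.NumberTheory.GaloisRepresentations.IdeleClassGroupLimitLayers
import Literature.NumberTheory.GaloisRepresentations.IdeleInflation
import HarnessLib

/-!
# The layers of `C̄ = lim→ C_E`: door-c4's transition `Hⁿ(Γ_F⧸U_E, C̄^{U_E}) → Hⁿ(Γ_F⧸U_{E'}, C̄^{U_{E'}})` IS the
# inflation `Hⁿ(Gal(E/F), C_E) → Hⁿ(Gal(E'/F), C_{E'})` of the idèle class formation
# (Serre, *Galois Cohomology* I §2.2 Prop. 8; Tate, C–F VII §11.1)

Topic `NumberTheory/GaloisRepresentations`; namespace `Literature.NumberTheory.GaloisRepresentations.IdeleClassBar`.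
Sequel to `IdeleClassGroupLimitLayers.lean` (door-c5 g16: `GalLayer.openNormalSubgroup E = U_E`, `GalLayer.quotEquiv`,
`layerRep E = C̄^{U_E}`, `layerEquiv`, `layerCohomologyIso E n : Hⁿ(Γ_F ⧸ U_E, C̄^{U_E}) ≅ Hⁿ(Gal(E/F), C_E)`) and
`IdeleInflation.lean` (`IdeleCohomology.classInf F E E' n = Hⁿ(res, classBaseChange)`).  Definitions with bodies and
theorems; NO named fact, no `sorry`, no instance, no notation.  Route A of crux `AnticycControlAdditiveK` (item 19295).

Mathematics.  For layers `E ≤ E'` (`U_{E'} ≤ U_E`) door-c4's system `U ↦ Hⁿ(Γ⧸U, M^U)` (`DiscreteRepLayerTransition`: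
`quotMap`, `invariantsStepIncl`; the `Ext` form `extInfStep`/`step` is identified with `groupCohomology.map quotMap incl`
by door-c4's dictionary) has the transition `Hⁿ(quotMap, incl) : Hⁿ(Γ_F⧸U_E, C̄^{U_E}) → Hⁿ(Γ_F⧸U_{E'}, C̄^{U_{E'}})`;
under the isomorphisms `layerCohomologyIso` of the previous file it is the inflation of the idèle class formation
(Serre I §2.2 Prop. 8: `Hq(G, A) = lim→ Hq(G/U, A^U)` over the open normal subgroups, the maps of the system being the
inflations; Tate VII §11.1: passage to the limit over the finite layers `E ⊆ K̄`): both are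
`groupCohomology.map` along the same homomorphism `Gal(E'/F) → Γ_F ⧸ U_E` (`σ|_{E'} ↦ [σ]`) and the same underlying
map `C̄^{U_E} → C_{E'}` (`[x] ↦ x_{E'}`).

Design note (the transition at `E = E'`).  The cell's `classInf F E E' n` is `Hⁿ(res, classBaseChange E E')`; along the
tautological algebra `E → E` the base change of idèle classes is not known in the tree to be the identity (module
docstring of `IdeleClassGroupLimit.lean`), so — exactly as g15's `transHom` — the system map `layerInf E E' h n` is
DEFINED as the identity for `E = E'` and as `classInf` otherwise (`layerInf_self`, `layerInf_of_ne`); the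
compatibility `map_invariantsStepIncl_comp_layerCohomologyIso` then holds uniformly in `E ≤ E'`, and at `E ≠ E'` it
is the `classInf` statement `map_invariantsStepIncl_comp_layerCohomologyIso_of_ne`.

## What is formalised (`F : Type` a number field, `Γ = absoluteGaloisGroup F`)

* `layerInf E E' h n` (+ `layerInf_self`, `layerInf_of_ne`), `quotMap_comp_quotEquiv_symm`
  (`quotMap ∘ quotEquiv_{E'}⁻¹ = quotEquiv_E⁻¹ ∘ res`),
  **`map_invariantsStepIncl_comp_layerCohomologyIso_of_ne`** (`Hⁿ(quotMap, incl) ≫ iso_{E'} = iso_E ≫ classInf F E E' n`),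
  `map_invariantsStepIncl_comp_layerCohomologyIso_self` (`Hⁿ(quotMap_{UU}, incl_{UU}) ≫ iso_E = iso_E`) and the uniform
  **`map_invariantsStepIncl_comp_layerCohomologyIso`** (`Hⁿ(quotMap, incl) ≫ iso_{E'} = iso_E ≫ layerInf E E' h n`).

## References
* J.-P. Serre, *Galois Cohomology*, Springer (1997), I §2.2 Proposition 8. [SerreGaloisCohomology1997]
* J. W. S. Cassels, A. Fröhlich (eds.), *Algebraic Number Theory* (1967), Ch. VII (J. Tate) §11.1. [CasselsFrohlichANT1967]
-/

noncomputable section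

open NumberField CategoryTheory groupCohomology
open Field (absoluteGaloisGroup)
open Literature.NumberTheory.Automorphic Literature.NumberTheory.Automorphic.IdeleClassGroup
open Literature.NumberTheory.NumberFields
open Literature.Algebra.Homology
open scoped Classical

namespace Literature.NumberTheory.GaloisRepresentations

namespace IdeleClassBar

variable {F : Type} [Field F] [NumberField F]

/-! ## §11. Compatibility with the transitions: `Hⁿ(quotMap, incl)` is the inflation `classInf` -/

/-- **The inflation on the layers of the idèle class formation, as a system indexed by `GalLayer F`**: the identity
for `E = E'` and the cell's `classInf F E E' n = Hⁿ(res, classBaseChange)` otherwise (design note in the module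
docstring; cf. g15's `transHom`). [cite: CasselsFrohlichANT1967, Ch. VII §11.1] -/
def layerInf (E E' : GalLayer F) (h : E ≤ E') (n : ℕ) :
    groupCohomology (haveI := E.numberField; IdeleClassGroup.galoisRep F E.1) n ⟶
      groupCohomology (haveI := E'.numberField; IdeleClassGroup.galoisRep F E'.1) n :=
  if heq : E = E' then eqToHom (by subst heq; rfl)
  else
    haveI := E.numberField
    haveI := E'.numberField
    haveI := E.isGalois
    letI := GalLayer.algebraOfLE h
    haveI := GalLayer.isScalarTower_of_le h
    IdeleCohomology.classInf F E.1 E'.1 n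

/-- `layerInf E E = 𝟙`. [cite: CasselsFrohlichANT1967, Ch. VII §11.1] -/
theorem layerInf_self (E : GalLayer F) (h : E ≤ E) (n : ℕ) : layerInf E E h n = 𝟙 _ := by
  rw [layerInf, dif_pos rfl, eqToHom_refl]

/-- For `E ≠ E'`, `layerInf E E'` is the inflation `classInf F E E'`. [cite: CasselsFrohlichANT1967, Ch. VII §11.1] -/
theorem layerInf_of_ne {E E' : GalLayer F} (h : E ≤ E') (hne : E ≠ E') (n : ℕ) :
    layerInf E E' h n =
      (haveI := E.numberField; haveI := E'.numberField; haveI := E.isGalois; letI := GalLayer.algebraOfLE h;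
        haveI := GalLayer.isScalarTower_of_le h; IdeleCohomology.classInf F E.1 E'.1 n) := by
  rw [layerInf, dif_neg hne]

/-- The two group homomorphisms `Gal(E'/F) → Γ_F ⧸ U_E` agree: `quotMap ∘ quotEquiv_{E'}⁻¹ = quotEquiv_E⁻¹ ∘ res`
(both send `σ|_{E'}` to `[σ]`). [cite: SerreGaloisCohomology1997, I §2.2 Proposition 8] -/
theorem quotMap_comp_quotEquiv_symm {E E' : GalLayer F} (h : E ≤ E') :
    (DiscreteRep.quotMap (E.openNormalSubgroup : Subgroup (absoluteGaloisGroup F))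
          (E'.openNormalSubgroup : Subgroup (absoluteGaloisGroup F)) (GalLayer.coe_openNormalSubgroup_le h)).comp
        E'.quotEquiv.symm.toMonoidHom =
      E.quotEquiv.symm.toMonoidHom.comp
        (haveI := E.isGalois; letI := GalLayer.algebraOfLE h; haveI := GalLayer.isScalarTower_of_le h;
          AlgEquiv.restrictNormalHom E.1) := by
  haveI := E.isGalois
  haveI := E'.isGalois
  letI := GalLayer.algebraOfLE h
  haveI := GalLayer.isScalarTower_of_le h
  refine MonoidHom.ext fun τ => ?_
  obtain ⟨σ, rfl⟩ :=
    AlgEquiv.restrictNormalHom_surjective (F := F) (K₁ := E'.1) (E := AlgebraicClosure F) τ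
  change DiscreteRep.quotMap _ _ (GalLayer.coe_openNormalSubgroup_le h) (E'.quotEquiv.symm (σ.restrictNormal E'.1)) =
    E.quotEquiv.symm ((σ.restrictNormal E'.1).restrictNormal E.1)
  rw [GalLayer.quotEquiv_symm_restrictNormal, restrictNormal_restrictNormal h σ,
    GalLayer.quotEquiv_symm_restrictNormal]
  rfl

/-- **`Hⁿ(quotMap, incl) ≫ iso_{E'} = iso_E ≫ classInf F E E' n` for `E < E'`**: door-c4's transition between the
layers `C̄^{U_E} ⊆ C̄^{U_{E'}}` IS the inflation of the idèle class formation (both are `groupCohomology.map` along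
the same homomorphism `Gal(E'/F) → Γ_F ⧸ U_E` and the same underlying map `C̄^{U_E} → C_{E'}`, `[x] ↦ x_{E'}`).
[cite: SerreGaloisCohomology1997, I §2.2 Proposition 8][cite: CasselsFrohlichANT1967, Ch. VII §11.1] -/
theorem map_invariantsStepIncl_comp_layerCohomologyIso_of_ne {E E' : GalLayer F} (h : E ≤ E') (hne : E ≠ E')
    (n : ℕ) :
    groupCohomology.map
        (DiscreteRep.quotMap (E.openNormalSubgroup : Subgroup (absoluteGaloisGroup F))
          (E'.openNormalSubgroup : Subgroup (absoluteGaloisGroup F)) (GalLayer.coe_openNormalSubgroup_le h))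
        (DiscreteRep.invariantsStepIncl (E.openNormalSubgroup : Subgroup (absoluteGaloisGroup F))
          (E'.openNormalSubgroup : Subgroup (absoluteGaloisGroup F)) (GalLayer.coe_openNormalSubgroup_le h)
          (classBarD F)) n ≫ (layerCohomologyIso E' n).hom =
      (layerCohomologyIso E n).hom ≫
        (haveI := E.numberField; haveI := E'.numberField; haveI := E.isGalois; letI := GalLayer.algebraOfLE h;
          haveI := GalLayer.isScalarTower_of_le h; IdeleCohomology.classInf F E.1 E'.1 n) := by
  haveI := E.numberField
  haveI := E'.numberField
  haveI := E.isGalois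
  haveI := E'.isGalois
  letI := GalLayer.algebraOfLE h
  haveI := GalLayer.isScalarTower_of_le h
  rw [layerCohomologyIso, layerCohomologyIso, groupCohomology.mapIso_hom, groupCohomology.mapIso_hom,
    IdeleCohomology.classInf, ← groupCohomology.map_comp, ← groupCohomology.map_comp]
  refine map_congr' (quotMap_comp_quotEquiv_symm h) _ _ (fun z => ?_) n
  change layerEquiv E' ((DiscreteRep.invariantsStepIncl (E.openNormalSubgroup : Subgroup (absoluteGaloisGroup F))
      (E'.openNormalSubgroup : Subgroup (absoluteGaloisGroup F)) (GalLayer.coe_openNormalSubgroup_le h)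
      (classBarD F)).hom z) =
    (IdeleCohomology.classInflHom F E.1 E'.1).hom (layerEquiv E z)
  rw [layerEquiv_invariantsStepIncl h, IdeleCohomology.classInflHom_hom_apply, transHom_of_ne h hne]
  rfl

/-- **At `E = E'` door-c4's transition is the identity under `layerCohomologyIso`**:
`Hⁿ(quotMap_{UU}, incl_{UU}) ≫ iso_E = iso_E` (`quotMap U U = id` and `incl_{UU} = id` on vectors).
[cite: SerreGaloisCohomology1997, I §2.2 Proposition 8] -/
theorem map_invariantsStepIncl_comp_layerCohomologyIso_self (E : GalLayer F) (h : E ≤ E) (n : ℕ) :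
    groupCohomology.map
        (DiscreteRep.quotMap (E.openNormalSubgroup : Subgroup (absoluteGaloisGroup F))
          (E.openNormalSubgroup : Subgroup (absoluteGaloisGroup F)) (GalLayer.coe_openNormalSubgroup_le h))
        (DiscreteRep.invariantsStepIncl (E.openNormalSubgroup : Subgroup (absoluteGaloisGroup F))
          (E.openNormalSubgroup : Subgroup (absoluteGaloisGroup F)) (GalLayer.coe_openNormalSubgroup_le h)
          (classBarD F)) n ≫ (layerCohomologyIso E n).hom =
      (layerCohomologyIso E n).hom := by
  haveI := E.numberField
  rw [layerCohomologyIso, groupCohomology.mapIso_hom, ← groupCohomology.map_comp]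
  have hf : (DiscreteRep.quotMap (E.openNormalSubgroup : Subgroup (absoluteGaloisGroup F))
        (E.openNormalSubgroup : Subgroup (absoluteGaloisGroup F)) (GalLayer.coe_openNormalSubgroup_le h)).comp
      E.quotEquiv.symm.toMonoidHom = E.quotEquiv.symm.toMonoidHom :=
    MonoidHom.ext fun τ => QuotientGroup.induction_on
      (C := fun q => DiscreteRep.quotMap (E.openNormalSubgroup : Subgroup (absoluteGaloisGroup F))
        (E.openNormalSubgroup : Subgroup (absoluteGaloisGroup F)) (GalLayer.coe_openNormalSubgroup_le h) q = q)
      (E.quotEquiv.symm τ) fun _ => rfl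
  exact map_congr' hf _ _ (fun _ => rfl) n

/-- **`Hⁿ(quotMap, incl) ≫ iso_{E'} = iso_E ≫ layerInf E E' h n` for all `E ≤ E'`** (uniform form: at `E = E'` both
transitions are the identity). [cite: SerreGaloisCohomology1997, I §2.2 Proposition 8] -/
theorem map_invariantsStepIncl_comp_layerCohomologyIso {E E' : GalLayer F} (h : E ≤ E') (n : ℕ) :
    groupCohomology.map
        (DiscreteRep.quotMap (E.openNormalSubgroup : Subgroup (absoluteGaloisGroup F))
          (E'.openNormalSubgroup : Subgroup (absoluteGaloisGroup F)) (GalLayer.coe_openNormalSubgroup_le h))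
        (DiscreteRep.invariantsStepIncl (E.openNormalSubgroup : Subgroup (absoluteGaloisGroup F))
          (E'.openNormalSubgroup : Subgroup (absoluteGaloisGroup F)) (GalLayer.coe_openNormalSubgroup_le h)
          (classBarD F)) n ≫ (layerCohomologyIso E' n).hom =
      (layerCohomologyIso E n).hom ≫ layerInf E E' h n := by
  by_cases heq : E = E'
  · subst heq
    rw [layerInf_self, Category.comp_id, map_invariantsStepIncl_comp_layerCohomologyIso_self E h n]
  · rw [layerInf_of_ne h heq]
    exact map_invariantsStepIncl_comp_layerCohomologyIso_of_ne h heq n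

end IdeleClassBar

end Literature.NumberTheory.GaloisRepresentations

end
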